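import Summits.CriticalPhenomena.PercolationContinuityZ3.Theorems.PercNearOneGluingNoHeavyLowerTailSwitchingKCopies
import HarnessLib

/-!
# `NoHeavyLowerTail` (stmt-CriticalPhenomena-4575) — k-copy switching, III: MULTI-SOURCE sequential exploration programs
# (each step explores an arbitrary copy and hands the region to an arbitrary other copy) preserve `μ^{⊗k}`

Support file (prover prim-masterthm-p1 gen 4, MASTER THEOREM P1 = k-uniform switching schema; `--supports stmt-CriticalPhenomena-4575`).
No named facts, no sorries.

The programs of `…SwitchingKSequential` explore copy `0` only (regions `R s (x 0)`).  The gen-4 census of the schema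
(`prim-masterthm-p1/REALROWS-G4.md`) shows that the certificates which exist for the open four-point rows (increasing star, γ,
the decreasing star, generic quartic letters) use words whose steps have DIFFERENT SOURCE copies — e.g. "hand the cluster of `u`
in copy `X` to copy `Y`, then the cluster of `v` in (the new) copy `Y` to copy `Z`".  This file proves the measure-preservation
lemma for that generality, once for every number of copies `k` and of steps `r`:
step `s` has a source copy `c s`, a target copy `T s` and a region `R s x ⊆ ι` (a function of the whole tuple `x`); the output
exchanges copies `c s` and `T s` on `R s x`.  Hypotheses: the regions of one tuple are pairwise disjoint (`RegionsDisjointM`) and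
region `s` is determined by the bits of the SOURCE copies `c j` on the regions `R j x`, `j ≤ s` (`RegionsDeterminedM`; for cluster
explorations through not-yet-queried edges this holds because step `s` reads copy `c s` exactly on `R s x`, where it still carries
its original bits).  Conclusion: the program permutes the copies coordinatewise and is injective (explicit left inverse by FORWARD
reconstruction of the regions from the output: after the program, copy `T s` carries on `R s x` the bits that step `s` read), hence
**`sum_wtKW_comp_msSplice`**: `Σ_x wtKW x · f (msSplice x) = Σ_x wtKW x · f x`.  Same uniqueness-of-the-tree-path argument as
[GladkovZimin2024, Lemma 4.2 / Thm. 4.6] and [Gladkov2024, Def. 2.4, Lemma 3.1], k copies, arbitrary sources.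

* `touchedM`, `usedM`, `msSplice`; `RegionsDisjointM`, `RegionsDeterminedM`;
* `mem_msSplice_of_mem` (transposition `(c s, T s)` on `R s x`), `permutesCopiesK_msSplice`, `msSplice_mem_tuplesK`;
* `regsM`/`regM`/`probeM`, `regM_msSplice` (regions recovered), `unMsSplice`, `unMsSplice_msSplice`, `msSplice_injective`;
* **`sum_wtKW_comp_msSplice`**.
-/

noncomputable section

open Classical

namespace Summit.CriticalPhenomena.PercolationContinuityZ3.Theorems

namespace SwitchingK

open Finset Literature.Probability.Percolation Literature.Probability.Percolation.DecisionTree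

variable {ι : Type*} [DecidableEq ι] {k : ℕ}

section MultiSource

/-- The coordinates at which copy `j` is involved in some exchange: the union of the regions `R s x`, `s < r`, whose source
or target is `j`. [cite: GladkovZimin2024, Def. 4.1; multi-source k-copy form] -/
def touchedM (R : ℕ → (Fin k → Finset ι) → Finset ι) (c T : ℕ → Fin k) (r : ℕ) (x : Fin k → Finset ι) (j : Fin k) :
    Finset ι :=
  (Finset.range r).biUnion fun s => if c s = j ∨ T s = j then R s x else ∅

/-- The union of all regions of the program at the tuple `x`. [cite: GladkovZimin2024, Def. 4.1; multi-source k-copy form] -/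
def usedM (R : ℕ → (Fin k → Finset ι) → Finset ι) (r : ℕ) (x : Fin k → Finset ι) : Finset ι :=
  (Finset.range r).biUnion fun s => R s x

/-- The output tuple of the multi-source sequential program: on the region `R s x` copies `c s` and `T s` exchange their bits,
every copy keeps its own bits off the regions that involve it. [cite: GladkovZimin2024, Def. 4.1 and proof of Thm. 4.6;
multi-source k-copy form] -/
def msSplice (R : ℕ → (Fin k → Finset ι) → Finset ι) (c T : ℕ → Fin k) (r : ℕ) (x : Fin k → Finset ι) :
    Fin k → Finset ι := fun j =>
  (x j \ touchedM R c T r x j) ∪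
    (Finset.range r).biUnion fun s => if c s = j then x (T s) ∩ R s x else if T s = j then x (c s) ∩ R s x else ∅

/-- Pairwise disjointness of the regions of one tuple. [cite: Gladkov2024, Def. 2.4 (disjoint explored sets)] -/
def RegionsDisjointM (R : ℕ → (Fin k → Finset ι) → Finset ι) (r : ℕ) : Prop :=
  ∀ x s s', s < r → s' < r → s ≠ s' → Disjoint (R s x) (R s' x)

/-- Region `s` is determined by the bits of the source copies `c j` on the regions `R j x`, `j ≤ s` (one-sided, forward form).
[cite: Gladkov2024, Def. 2.4 and Lemma 3.1 (a set built by a decision tree is determined by the queried coordinates);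
multi-source sequential form] -/
def RegionsDeterminedM (R : ℕ → (Fin k → Finset ι) → Finset ι) (c : ℕ → Fin k) (r : ℕ) : Prop :=
  ∀ s, s < r → ∀ x x' : Fin k → Finset ι,
    (∀ j, j ≤ s → ∀ i, i ∈ R j x → (i ∈ x (c j) ↔ i ∈ x' (c j))) → R s x' = R s x

variable {R : ℕ → (Fin k → Finset ι) → Finset ι} {c T : ℕ → Fin k} {r : ℕ}

/-- Membership in `touchedM`. [folklore] -/
theorem mem_touchedM {x : Fin k → Finset ι} {j : Fin k} {i : ι} :
    i ∈ touchedM R c T r x j ↔ ∃ s, s < r ∧ (c s = j ∨ T s = j) ∧ i ∈ R s x := by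
  unfold touchedM
  simp only [mem_biUnion, mem_range]
  constructor
  · rintro ⟨s, hs, hi⟩
    by_cases h : c s = j ∨ T s = j
    · rw [if_pos h] at hi; exact ⟨s, hs, h, hi⟩
    · rw [if_neg h] at hi; simp at hi
  · rintro ⟨s, hs, h, hi⟩
    exact ⟨s, hs, by rw [if_pos h]; exact hi⟩

/-- Membership in `usedM`. [folklore] -/
theorem mem_usedM {x : Fin k → Finset ι} {i : ι} : i ∈ usedM R r x ↔ ∃ s, s < r ∧ i ∈ R s x := by
  unfold usedM; simp only [mem_biUnion, mem_range]

omit [DecidableEq ι] in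
/-- Membership in the three-way conditional pieces of `msSplice`. [folklore] -/
theorem mem_ite_ite_empty {p q : Prop} [Decidable p] [Decidable q] {A B : Finset ι} {i : ι} :
    i ∈ (if p then A else if q then B else (∅ : Finset ι)) ↔ (p ∧ i ∈ A) ∨ (¬ p ∧ q ∧ i ∈ B) := by
  split_ifs <;> simp [*]

omit [DecidableEq ι] in
/-- Under disjointness at `x`, the step whose region contains a given coordinate is unique. [folklore] -/
theorem step_uniqueM (hd : RegionsDisjointM R r) {x : Fin k → Finset ι} {i : ι} {s s' : ℕ} (hs : s < r)
    (hs' : s' < r) (hi : i ∈ R s x) (hi' : i ∈ R s' x) : s = s' := by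
  by_contra h
  exact Finset.disjoint_left.1 (hd x s s' hs hs' h) hi hi'

/-- On the region of step `s`, the output copy `j` carries the bit of copy `swap (c s) (T s) j`: copies `c s` and `T s` are
exchanged there, the others untouched. [cite: GladkovZimin2024, Def. 4.1; multi-source k-copy form] -/
theorem mem_msSplice_of_mem (hd : RegionsDisjointM R r) {x : Fin k → Finset ι} {i : ι} {s : ℕ} (hs : s < r)
    (hi : i ∈ R s x) (j : Fin k) : i ∈ msSplice R c T r x j ↔ i ∈ x (Equiv.swap (c s) (T s) j) := by
  unfold msSplice
  simp only [mem_union, mem_sdiff, mem_biUnion, mem_range, mem_touchedM, mem_ite_ite_empty, mem_inter]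
  constructor
  · rintro (⟨hxj, hnt⟩ | ⟨s', hs', hcase⟩)
    · have hne : ¬ (c s = j ∨ T s = j) := fun h => hnt ⟨s, hs, h, hi⟩
      have h1 : j ≠ c s := fun h => hne (Or.inl h.symm)
      have h2 : j ≠ T s := fun h => hne (Or.inr h.symm)
      rwa [Equiv.swap_apply_of_ne_of_ne h1 h2]
    · rcases hcase with ⟨hcj, hxT, hiR⟩ | ⟨hncj, hTj, hxc, hiR⟩
      · have := step_uniqueM hd hs hs' hi hiR; subst this
        subst hcj; rwa [Equiv.swap_apply_left]
      · have := step_uniqueM hd hs hs' hi hiR; subst this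
        subst hTj; rwa [Equiv.swap_apply_right]
  · intro h
    by_cases hcj : c s = j
    · subst hcj; rw [Equiv.swap_apply_left] at h
      exact Or.inr ⟨s, hs, Or.inl ⟨rfl, h, hi⟩⟩
    · by_cases hTj : T s = j
      · subst hTj; rw [Equiv.swap_apply_right] at h
        exact Or.inr ⟨s, hs, Or.inr ⟨hcj, rfl, h, hi⟩⟩
      · have h1 : j ≠ c s := fun h' => hcj h'.symm
        have h2 : j ≠ T s := fun h' => hTj h'.symm
        rw [Equiv.swap_apply_of_ne_of_ne h1 h2] at h
        exact Or.inl ⟨h, fun ⟨s', hs', hc', hi'⟩ => by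
          have := step_uniqueM hd hs hs' hi hi'; subst this
          exact (hc'.elim hcj hTj)⟩

/-- Off all regions every output copy carries its own bit. [cite: GladkovZimin2024, Def. 4.1; multi-source k-copy form] -/
theorem mem_msSplice_of_not_mem {x : Fin k → Finset ι} {i : ι} (hi : i ∉ usedM R r x) (j : Fin k) :
    i ∈ msSplice R c T r x j ↔ i ∈ x j := by
  unfold msSplice
  simp only [mem_union, mem_sdiff, mem_biUnion, mem_range, mem_touchedM, mem_ite_ite_empty, mem_inter]
  constructor
  · rintro (⟨h, -⟩ | ⟨s', hs', hcase⟩)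
    · exact h
    · rcases hcase with ⟨-, -, hiR⟩ | ⟨-, -, -, hiR⟩ <;> exact absurd (mem_usedM.2 ⟨s', hs', hiR⟩) hi
  · intro h
    exact Or.inl ⟨h, fun ⟨s', hs', _, hi'⟩ => hi (mem_usedM.2 ⟨s', hs', hi'⟩)⟩

/-- The multi-source program permutes the copies coordinatewise: transposition `(c s, T s)` on `R s x`, identity off the
regions. [cite: GladkovZimin2024, Def. 4.1 and Lemma 4.2; multi-source k-copy form] -/
theorem permutesCopiesK_msSplice (hd : RegionsDisjointM R r) : PermutesCopiesK (msSplice R c T r) := by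
  intro x i
  by_cases hu : i ∈ usedM R r x
  · obtain ⟨s, hs, hi⟩ := mem_usedM.1 hu
    exact ⟨Equiv.swap (c s) (T s), fun j => mem_msSplice_of_mem hd hs hi j⟩
  · exact ⟨Equiv.refl _, fun j => by simpa using mem_msSplice_of_not_mem hu j⟩

/-- The program maps tuples inside `D` to tuples inside `D`. [folklore] -/
theorem msSplice_mem_tuplesK {D : Finset ι} {x : Fin k → Finset ι} (hx : x ∈ tuplesK D k) :
    msSplice R c T r x ∈ tuplesK D k := by
  have h := mem_tuplesK.1 hx
  refine mem_tuplesK.2 fun j => ?_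
  intro i hi
  unfold msSplice at hi
  simp only [mem_union, mem_sdiff, mem_biUnion, mem_range, mem_ite_ite_empty, mem_inter] at hi
  rcases hi with ⟨hi, -⟩ | ⟨s, -, (⟨-, hi, -⟩ | ⟨-, -, hi, -⟩)⟩
  · exact h j hi
  · exact h (T s) hi
  · exact h (c s) hi

/-! ### Recovering the regions from the output, forward in the step order -/

/-- `regsM y s` lists the first `s` regions reconstructed from the output tuple `y` (and `∅` from index `s` on): region
`s` is `R s` applied to the PROBE tuple whose copy `l` carries `y (T j)` on the reconstructed region `j < s` when `c j = l`,
and whose copy `c s` carries `y (T s)` off the reconstructed regions — a tuple whose source copies agree with those of the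
input on `R 0 x, …, R s x`. [cite: GladkovZimin2024, proof of Lemma 4.2 (uniqueness of the tree path); multi-source form] -/
def regsM (R : ℕ → (Fin k → Finset ι) → Finset ι) (c T : ℕ → Fin k) (y : Fin k → Finset ι) : ℕ → ℕ → Finset ι
  | 0 => fun _ => ∅
  | s + 1 => fun j =>
      if j < s then regsM R c T y s j
      else if j = s then
        R s (fun l => ((if l = c s then y (T s) else ∅) \ (Finset.range s).biUnion (regsM R c T y s)) ∪
              (Finset.range s).biUnion (fun m => if c m = l then y (T m) ∩ regsM R c T y s m else ∅))
      else ∅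

/-- The reconstructed region `j` (read at stage `j + 1`). [folklore] -/
def regM (R : ℕ → (Fin k → Finset ι) → Finset ι) (c T : ℕ → Fin k) (y : Fin k → Finset ι) (j : ℕ) : Finset ι :=
  regsM R c T y (j + 1) j

/-- The probe tuple of stage `s`, written with `regM`. [folklore] -/
def probeM (R : ℕ → (Fin k → Finset ι) → Finset ι) (c T : ℕ → Fin k) (y : Fin k → Finset ι) (s : ℕ) :
    Fin k → Finset ι := fun l =>
  ((if l = c s then y (T s) else ∅) \ (Finset.range s).biUnion (regM R c T y)) ∪
    (Finset.range s).biUnion (fun m => if c m = l then y (T m) ∩ regM R c T y m else ∅)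

/-- The successor stage of `regsM`, unfolded. [folklore] -/
theorem regsM_succ (y : Fin k → Finset ι) (s j : ℕ) :
    regsM R c T y (s + 1) j = (if j < s then regsM R c T y s j
      else if j = s then
        R s (fun l => ((if l = c s then y (T s) else ∅) \ (Finset.range s).biUnion (regsM R c T y s)) ∪
              (Finset.range s).biUnion (fun m => if c m = l then y (T m) ∩ regsM R c T y s m else ∅))
      else ∅) := rfl

/-- `regsM` is stable: for `j < s ≤ s'`, `regsM y s' j = regsM y s j`. [folklore] -/
theorem regsM_stable (y : Fin k → Finset ι) {j s : ℕ} (hjs : j < s) :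
    ∀ s', s ≤ s' → regsM R c T y s' j = regsM R c T y s j := by
  intro s' hss'
  induction s' with
  | zero => exact absurd (Nat.lt_of_lt_of_le hjs hss') (Nat.not_lt_zero j)
  | succ n ih =>
      rcases Nat.eq_or_lt_of_le hss' with h | h
      · rw [h]
      · have hn : s ≤ n := Nat.lt_succ_iff.1 h
        have hjn : j < n := Nat.lt_of_lt_of_le hjs hn
        rw [regsM_succ, if_pos hjn, ih hn]

/-- For `j < s`, stage `s` already holds the reconstructed region `j`. [folklore] -/
theorem regsM_eq_regM (y : Fin k → Finset ι) {j s : ℕ} (hjs : j < s) : regsM R c T y s j = regM R c T y j :=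
  regsM_stable y (Nat.lt_succ_self j) s hjs

/-- The defining equation of `regM`: `regM y s = R s (probeM y s)`. [folklore] -/
theorem regM_eq (y : Fin k → Finset ι) (s : ℕ) : regM R c T y s = R s (probeM R c T y s) := by
  have hb1 : (Finset.range s).biUnion (regsM R c T y s) = (Finset.range s).biUnion (regM R c T y) :=
    Finset.biUnion_congr rfl fun l hl => regsM_eq_regM y (mem_range.1 hl)
  have hb2 : ∀ l : Fin k, (Finset.range s).biUnion (fun m => if c m = l then y (T m) ∩ regsM R c T y s m else ∅) =
      (Finset.range s).biUnion (fun m => if c m = l then y (T m) ∩ regM R c T y m else ∅) := fun l =>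
    Finset.biUnion_congr rfl fun m hm => by rw [regsM_eq_regM y (mem_range.1 hm)]
  rw [show regM R c T y s = regsM R c T y (s + 1) s from rfl, regsM_succ, if_neg (lt_irrefl s), if_pos rfl]
  unfold probeM
  congr 1
  funext l
  rw [hb1, hb2 l]

/-- **The regions are recovered from the output**: for every step `s < r`, `regM (msSplice x) s = R s x`.
[cite: GladkovZimin2024, proof of Lemma 4.2 (uniqueness of the tree path); multi-source k-copy form] -/
theorem regM_msSplice (hd : RegionsDisjointM R r) (hdet : RegionsDeterminedM R c r)
    (x : Fin k → Finset ι) : ∀ s, s < r → regM R c T (msSplice R c T r x) s = R s x := by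
  intro s
  induction s using Nat.strong_induction_on with
  | _ s ih =>
    intro hs
    rw [regM_eq]
    apply hdet s hs
    intro j hjs i hij
    -- the output copy `T j` carries the bit of `x (c j)` at `i ∈ R j x`
    have hyT : ∀ {l}, l < r → i ∈ R l x → (i ∈ msSplice R c T r x (T l) ↔ i ∈ x (c l)) := by
      intro l hl hil
      rw [mem_msSplice_of_mem hd hl hil, Equiv.swap_apply_right]
    have hjr : j < r := Nat.lt_of_le_of_lt hjs hs
    unfold probeM
    simp only [mem_union, mem_sdiff, mem_biUnion, mem_range]
    rcases Nat.lt_or_eq_of_le hjs with hlt | heq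
    · -- j < s: i lies in the reconstructed region j = R j x
      have hregj : regM R c T (msSplice R c T r x) j = R j x := ih j hlt hjr
      constructor
      · intro hx0
        refine Or.inr ⟨j, hlt, ?_⟩
        rw [if_pos rfl, mem_inter, hregj]
        exact ⟨(hyT hjr hij).2 hx0, hij⟩
      · rintro (⟨-, hnot⟩ | ⟨l, hls, hl⟩)
        · exact absurd ⟨j, hlt, by rw [hregj]; exact hij⟩ hnot
        · by_cases hcl : c l = c j
          · rw [if_pos hcl, mem_inter] at hl
            have hlr : l < r := Nat.lt_trans hls hs
            rw [ih l hls hlr] at hl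
            have := step_uniqueM hd hjr hlr hij hl.2
            subst this
            exact (hyT hjr hij).1 hl.1
          · rw [if_neg hcl] at hl; simp at hl
    · -- j = s: i is in no earlier region; copy c s of the probe carries y (T s) there
      subst heq
      have hnot : ¬ ∃ l, l < j ∧ i ∈ regM R c T (msSplice R c T r x) l := by
        rintro ⟨l, hlj, hil⟩
        have hlr : l < r := Nat.lt_trans hlj hs
        rw [ih l hlj hlr] at hil
        exact absurd (step_uniqueM hd hjr hlr hij hil) (Nat.ne_of_gt hlj)
      constructor
      · intro hx0
        refine Or.inl ⟨?_, hnot⟩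
        rw [if_pos rfl]; exact (hyT hjr hij).2 hx0
      · rintro (⟨hy, -⟩ | ⟨l, hlj, hl⟩)
        · rw [if_pos rfl] at hy; exact (hyT hjr hij).1 hy
        · by_cases hcl : c l = c j
          · rw [if_pos hcl, mem_inter] at hl
            exact absurd ⟨l, hlj, hl.2⟩ hnot
          · rw [if_neg hcl] at hl; simp at hl

/-- The explicit left inverse of the program: exchange back copies `c s` and `T s` on the RECONSTRUCTED regions `regM y s`
(the same splice with regions read off the output). [cite: GladkovZimin2024, proof of Lemma 4.2; multi-source k-copy form] -/
def unMsSplice (R : ℕ → (Fin k → Finset ι) → Finset ι) (c T : ℕ → Fin k) (r : ℕ) (y : Fin k → Finset ι) :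
    Fin k → Finset ι :=
  msSplice (fun s _ => regM R c T y s) c T r y

/-- `unMsSplice` is a left inverse of `msSplice`. [cite: GladkovZimin2024, proof of Lemma 4.2; multi-source k-copy form] -/
theorem unMsSplice_msSplice (hd : RegionsDisjointM R r) (hdet : RegionsDeterminedM R c r)
    (x : Fin k → Finset ι) : unMsSplice R c T r (msSplice R c T r x) = x := by
  set y := msSplice R c T r x with hy
  have hreg := regM_msSplice (T := T) hd hdet x
  -- the regions used by the inverse are the constant regions `R s x`
  have hR' : (fun s (_ : Fin k → Finset ι) => regM R c T y s) = fun s _ => if s < r then R s x else regM R c T y s := by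
    funext s z
    by_cases hs : s < r
    · rw [if_pos hs, hreg s hs]
    · rw [if_neg hs]
  have hd' : RegionsDisjointM (fun s (_ : Fin k → Finset ι) => if s < r then R s x else regM R c T y s) r := by
    intro z s s' hs hs' hne
    simp only [if_pos hs, if_pos hs']
    exact hd x s s' hs hs' hne
  unfold unMsSplice
  rw [hR']
  funext j
  ext i
  by_cases hu : i ∈ usedM R r x
  · obtain ⟨s, hs, hi⟩ := mem_usedM.1 hu
    have hi' : i ∈ (fun s (_ : Fin k → Finset ι) => if s < r then R s x else regM R c T y s) s y := by
      simp only [if_pos hs]; exact hi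
    rw [mem_msSplice_of_mem hd' hs hi' j, hy, mem_msSplice_of_mem hd hs hi, Equiv.swap_apply_self]
  · have hu' : i ∉ usedM (fun s (_ : Fin k → Finset ι) => if s < r then R s x else regM R c T y s) r y := by
      intro h
      obtain ⟨s, hs, hi⟩ := mem_usedM.1 h
      simp only [if_pos hs] at hi
      exact hu (mem_usedM.2 ⟨s, hs, hi⟩)
    rw [mem_msSplice_of_not_mem hu' j, hy, mem_msSplice_of_not_mem hu j]

/-- The multi-source program is injective. [cite: GladkovZimin2024, proof of Lemma 4.2; multi-source k-copy form] -/
theorem msSplice_injective (hd : RegionsDisjointM R r) (hdet : RegionsDeterminedM R c r) :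
    Function.Injective (msSplice R c T r) :=
  Function.LeftInverse.injective (unMsSplice_msSplice hd hdet)

/-- **Every multi-source sequential exploration program preserves `μ^{⊗k}`** (all `k`, all numbers of steps `r`, arbitrary
source and target copies per step): for regions that are pairwise disjoint and determined forward by the source copies, and
every `f`, `Σ_x wtKW x · f (msSplice x) = Σ_x wtKW x · f x`.  With `c ≡ 0` this is `sum_wtKW_comp_seqSplice` of
`…SwitchingKSequential` up to the bookkeeping of the regions. [cite: GladkovZimin2024, Lemma 4.2 and proof of Thm. 4.6;
Gladkov2024, Lemma 3.1 — multi-source k-copy form, same counting proof] -/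
theorem sum_wtKW_comp_msSplice (p : ι → ℝ) (hd : RegionsDisjointM R r) (hdet : RegionsDeterminedM R c r)
    (D : Finset ι) (f : (Fin k → Finset ι) → ℝ) :
    ∑ x ∈ tuplesK D k, wtKW D p x * f (msSplice R c T r x) = ∑ x ∈ tuplesK D k, wtKW D p x * f x :=
  sum_wtKW_comp_eq_of_injOn p (permutesCopiesK_msSplice hd) D (fun _ hx => msSplice_mem_tuplesK hx)
    (fun _ _ _ _ h => msSplice_injective hd hdet h) f

end MultiSource

end SwitchingK

end Summit.CriticalPhenomena.PercolationContinuityZ3.Theorems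

end
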